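import Summits.CriticalPhenomena.SAWScalingLimit.Theorems.SAWDefectDecoherenceObservableToSLERCarvedReductionSqueezeLegsPrep
import HarnessLib

/-!
# The corridor below a LOWERED window: an open box under the gate frame minus the closed lowered
# window disc is open, connected, carries the docks and misses the frame rectangle and the gate ball
# (piece (T-A′ P1-low) of stub T-A′ `stub_carvedReduction_squeezeGeometry_domains`)

Crux `SAWDevelopingMap.ObservableToSLE` (stmt-CriticalPhenomena-10472), line `six-class-type-ladder`,
stub T-A′ `stub_carvedReduction_squeezeGeometry_domains`.  Landing target:
`Summits/CriticalPhenomena/SAWScalingLimit/Theorems/SAWDevelopingMapObservableToSLETypeLadderCarvedReductionSqueezeLowWindow.lean`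
(`--supports stmt-CriticalPhenomena-10472`; registered carrier `stub_carvedReduction_lowWindow`).

The window cross-cut of the framed super-domain (`…SqueezeSuperFrame`) is produced by the twin's
`Squeeze.stub_carvedReduction_legsToCrosscut` applied to the LOWERED window
`closedBall (P - h i) ρ'` under the gate `P` (frame half-width `ρ'`, frame depth `h`), inside a
corridor which near the gate is the open box
`V = {|re z - re P| < W₁, im P - H₁ < im z < im P - h}` minus the closed lowered disc
`K = closedBall (P - h i) ρ'` (in the squeeze: inside the exactly removed lower half of the window
ball).  This file is its elementary geometry (`stub_carvedReduction_lowWindow`): `V ∖ K` is open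
and CONNECTED (every point is joined horizontally, away from the disc, to one of the two convex side
boxes `{±(re z - re P) > ρ'}`, which are joined through the convex bottom box
`{im z < im P - h - ρ'}`), contains the two docks hanging from the lowered diameter ends (but their
tops), lies below depth `h` (so misses the closed frame rectangle and the closed gate ball of any
radius `≤ h`) and misses `K`.
-/

noncomputable section
open scoped Topology
open Filter Set Metric
open Literature.Probability.RandomPlanarGeometry

namespace Summit.CriticalPhenomena.SAWScalingLimit.Theorems.ObservableToSLE.TypeLadder

open Summit.CriticalPhenomena.SAWScalingLimit.Theorems.ObservableToSLER.Squeeze (mem_dock)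

section LowWindow

variable {P : ℂ} {ρ' h W₁ H₁ : ℝ}

/-- Distance to the lowered centre `P - h i` dominates the horizontal offset. -/
theorem re_le_dist_lowCentre (z : ℂ) : |z.re - P.re| ≤ dist z (P - h * Complex.I) := by
  have : (z - (P - h * Complex.I)).re = z.re - P.re := by simp
  rw [dist_eq_norm, ← this]
  exact Complex.abs_re_le_norm _

/-- Distance to the lowered centre `P - h i` dominates the vertical offset. -/
theorem im_le_dist_lowCentre (z : ℂ) : |z.im - (P.im - h)| ≤ dist z (P - h * Complex.I) := by
  have : (z - (P - h * Complex.I)).im = z.im - (P.im - h) := by simp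
  rw [dist_eq_norm, ← this]
  exact Complex.abs_im_le_norm _

/-- **The corridor below a lowered window is connected** (and open): for `0 < ρ' < W₁`, `0 < h`,
`h + ρ' < H₁`, the open box `{|re z - re P| < W₁, im P - H₁ < im z < im P - h}` minus
`closedBall (P - h i) ρ'` (here `0 < h` is not even needed). -/
theorem isConnected_lowWindow (hρ' : 0 < ρ') (hW : ρ' < W₁) (hH : h + ρ' < H₁) :
    IsConnected ({z : ℂ | |z.re - P.re| < W₁ ∧ P.im - H₁ < z.im ∧ z.im < P.im - h} \
      closedBall (P - h * Complex.I) ρ') := by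
  set V : Set ℂ := {z : ℂ | |z.re - P.re| < W₁ ∧ P.im - H₁ < z.im ∧ z.im < P.im - h} with hV
  set K : Set ℂ := closedBall (P - h * Complex.I) ρ' with hK
  -- the three convex boxes off the disc
  set B : Set ℂ := V ∩ {z : ℂ | P.re + ρ' < z.re} with hB
  set A : Set ℂ := V ∩ {z : ℂ | z.re < P.re - ρ'} with hA
  set C : Set ℂ := V ∩ {z : ℂ | z.im < P.im - h - ρ'} with hC
  have hVconv : Convex ℝ V := by
    have : V = ({z : ℂ | P.re - W₁ < z.re} ∩ {z : ℂ | z.re < P.re + W₁}) ∩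
        ({z : ℂ | P.im - H₁ < z.im} ∩ {z : ℂ | z.im < P.im - h}) := by
      ext z; simp only [hV, mem_setOf_eq, mem_inter_iff, abs_lt]
      constructor
      · rintro ⟨⟨h1, h2⟩, h3, h4⟩; exact ⟨⟨by linarith, by linarith⟩, h3, h4⟩
      · rintro ⟨⟨h1, h2⟩, h3, h4⟩; exact ⟨⟨by linarith, by linarith⟩, h3, h4⟩
    rw [this]
    exact ((convex_halfSpace_re_gt _).inter (convex_halfSpace_re_lt _)).inter
      ((convex_halfSpace_im_gt _).inter (convex_halfSpace_im_lt _))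
  have hBconv : Convex ℝ B := hVconv.inter (convex_halfSpace_re_gt _)
  have hAconv : Convex ℝ A := hVconv.inter (convex_halfSpace_re_lt _)
  have hCconv : Convex ℝ C := hVconv.inter (convex_halfSpace_im_lt _)
  have hBsub : B ⊆ V \ K := by
    rintro z ⟨hzV, hzB⟩
    refine ⟨hzV, fun hzK => ?_⟩
    have h1 := re_le_dist_lowCentre (P := P) (h := h) z
    rw [mem_closedBall] at hzK
    have h2 : P.re + ρ' < z.re := hzB
    rw [abs_of_pos (by linarith)] at h1
    linarith
  have hAsub : A ⊆ V \ K := by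
    rintro z ⟨hzV, hzA⟩
    refine ⟨hzV, fun hzK => ?_⟩
    have h1 := re_le_dist_lowCentre (P := P) (h := h) z
    rw [mem_closedBall] at hzK
    have h2 : z.re < P.re - ρ' := hzA
    rw [abs_of_neg (by linarith)] at h1
    linarith
  have hCsub : C ⊆ V \ K := by
    rintro z ⟨hzV, hzC⟩
    refine ⟨hzV, fun hzK => ?_⟩
    have h1 := im_le_dist_lowCentre (P := P) (h := h) z
    rw [mem_closedBall] at hzK
    have h2 : z.im < P.im - h - ρ' := hzC
    rw [abs_of_neg (by linarith)] at h1
    linarith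
  -- reference points
  set yC : ℝ := P.im - (h + ρ' + H₁) / 2 with hyC
  have hyC1 : P.im - H₁ < yC := by rw [hyC]; linarith
  have hyC2 : yC < P.im - h - ρ' := by rw [hyC]; linarith
  set xB : ℝ := P.re + (ρ' + W₁) / 2 with hxB
  set xA : ℝ := P.re - (ρ' + W₁) / 2 with hxA
  set c : ℂ := ⟨P.re, yC⟩ with hc
  set bB : ℂ := ⟨xB, yC⟩ with hbB
  set bA : ℂ := ⟨xA, yC⟩ with hbA
  have hcC : c ∈ C := ⟨⟨by simp [hc]; linarith, by simp [hc]; linarith, by simp [hc]; linarith⟩,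
    by show c.im < P.im - h - ρ'; simp [hc]; linarith⟩
  have hbBB : bB ∈ B := ⟨⟨by simp [hbB, hxB, abs_lt]; constructor <;> linarith, by simp [hbB]; linarith,
    by simp [hbB]; linarith⟩, by show P.re + ρ' < bB.re; simp [hbB, hxB]; linarith⟩
  have hbBC : bB ∈ C := ⟨hbBB.1, by show bB.im < P.im - h - ρ'; simp [hbB]; linarith⟩
  have hbAA : bA ∈ A := ⟨⟨by simp [hbA, hxA, abs_lt]; constructor <;> linarith, by simp [hbA]; linarith,
    by simp [hbA]; linarith⟩, by show bA.re < P.re - ρ'; simp [hbA, hxA]; linarith⟩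
  have hbAC : bA ∈ C := ⟨hbAA.1, by show bA.im < P.im - h - ρ'; simp [hbA]; linarith⟩
  -- joining inside the convex boxes
  have hjoinC : ∀ {u v : ℂ}, u ∈ C → v ∈ C → JoinedIn (V \ K) u v := fun hu hv =>
    (JoinedIn.of_segment_subset ((hCconv.segment_subset hu hv).trans hCsub))
  have hjoinB : ∀ {u v : ℂ}, u ∈ B → v ∈ B → JoinedIn (V \ K) u v := fun hu hv =>
    (JoinedIn.of_segment_subset ((hBconv.segment_subset hu hv).trans hBsub))
  have hjoinA : ∀ {u v : ℂ}, u ∈ A → v ∈ A → JoinedIn (V \ K) u v := fun hu hv =>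
    (JoinedIn.of_segment_subset ((hAconv.segment_subset hu hv).trans hAsub))
  -- every point is joined to `c`
  have hjoin : ∀ z ∈ V \ K, JoinedIn (V \ K) z c := by
    rintro z ⟨hzV, hzK⟩
    obtain ⟨hzre, hzim1, hzim2⟩ := hzV
    have hzK' : ρ' < dist z (P - h * Complex.I) := lt_of_not_ge fun h' => hzK (mem_closedBall.2 h')
    rcases le_total P.re z.re with hside | hside
    · -- right half: horizontal segment to the point `z'` of abscissa `xB`
      set z' : ℂ := ⟨xB, z.im⟩ with hz'
      have hz'B : z' ∈ B := ⟨⟨by simp [hz', hxB, abs_lt]; constructor <;> linarith, by simp [hz']; linarith,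
        by simp [hz']; linarith⟩, by show P.re + ρ' < z'.re; simp [hz', hxB]; linarith⟩
      have hseg : segment ℝ z z' ⊆ V \ K := by
        rw [segment_eq_image']
        rintro _ ⟨θ, hθ, rfl⟩
        have hre : (z + θ • (z' - z)).re = z.re + θ * (xB - z.re) := by simp [hz']
        have him : (z + θ • (z' - z)).im = z.im := by simp [hz']
        have hconv : z.re + θ * (xB - z.re) - P.re = (1 - θ) * (z.re - P.re) + θ * (xB - P.re) := by ring
        obtain ⟨ha1, ha2⟩ := abs_lt.1 hzre
        have hb1 : 0 < xB - P.re := by rw [hxB]; linarith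
        have hb2 : xB - P.re < W₁ := by rw [hxB]; linarith
        have h1θ : 0 ≤ 1 - θ := by linarith [hθ.2]
        have hp1 : 0 ≤ (1 - θ) * (z.re - P.re) := mul_nonneg h1θ (by linarith)
        have hp2 : 0 ≤ θ * (xB - P.re) := mul_nonneg hθ.1 hb1.le
        have hWre : |(z + θ • (z' - z)).re - P.re| < W₁ := by
          rw [hre, abs_lt, hconv]
          set M : ℝ := max (z.re - P.re) (xB - P.re) with hM
          have hMW : M < W₁ := max_lt ha2 hb2
          have hq1 := mul_le_mul_of_nonneg_left (le_max_left (z.re - P.re) (xB - P.re)) h1θ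
          have hq2 := mul_le_mul_of_nonneg_left (le_max_right (z.re - P.re) (xB - P.re)) hθ.1
          have hid : (1 - θ) * M + θ * M = M := by ring
          constructor
          · linarith
          · linarith
        refine ⟨⟨hWre, by rw [him]; exact hzim1, by rw [him]; exact hzim2⟩, fun hwK => ?_⟩
        rw [mem_closedBall] at hwK
        have h1 := re_le_dist_lowCentre (P := P) (h := h) (z + θ • (z' - z))
        rw [hre] at h1
        -- either the abscissa did not decrease (then the distance did not) or it exceeds `ρ'`
        by_cases hcase : z.re ≤ xB
        · have hzdist : dist z (P - ↑h * Complex.I) ^ 2 = (z.re - P.re) ^ 2 + (z.im - (P.im - h)) ^ 2 := by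
            rw [dist_eq_norm, Complex.sq_norm, Complex.normSq_apply]; simp; ring
          have hwdist : dist (z + θ • (z' - z)) (P - ↑h * Complex.I) ^ 2 =
              (z.re + θ * (xB - z.re) - P.re) ^ 2 + (z.im - (P.im - h)) ^ 2 := by
            rw [dist_eq_norm, Complex.sq_norm, Complex.normSq_apply]; simp [hz']; ring
          have h0 : 0 ≤ z.re - P.re := by linarith
          have hq : 0 ≤ θ * (xB - z.re) := mul_nonneg hθ.1 (by linarith)
          have h0' : z.re - P.re ≤ z.re + θ * (xB - z.re) - P.re := by linarith
          have hmono : (z.re - P.re) ^ 2 ≤ (z.re + θ * (xB - z.re) - P.re) ^ 2 :=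
            pow_le_pow_left₀ h0 h0' 2
          have hle : dist z (P - ↑h * Complex.I) ^ 2 ≤ dist (z + θ • (z' - z)) (P - ↑h * Complex.I) ^ 2 := by
            rw [hzdist, hwdist]; linarith
          have hlt : dist (z + θ • (z' - z)) (P - ↑h * Complex.I) ^ 2 < dist z (P - ↑h * Complex.I) ^ 2 :=
            pow_lt_pow_left₀ (hwK.trans_lt hzK') dist_nonneg two_ne_zero
          linarith
        · push Not at hcase
          have hq : 0 ≤ (1 - θ) * (z.re - xB) := mul_nonneg h1θ (by linarith)
          have : ρ' < z.re + θ * (xB - z.re) - P.re := by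
            rw [show z.re + θ * (xB - z.re) - P.re = (xB - P.re) + (1 - θ) * (z.re - xB) by ring]
            have : ρ' < xB - P.re := by rw [hxB]; linarith
            linarith
          rw [abs_of_pos (by linarith)] at h1
          linarith
      exact (JoinedIn.of_segment_subset hseg).trans ((hjoinB hz'B hbBB).trans (hjoinC hbBC hcC))
    · -- left half: mirror image
      set z' : ℂ := ⟨xA, z.im⟩ with hz'
      have hz'A : z' ∈ A := ⟨⟨by simp [hz', hxA, abs_lt]; constructor <;> linarith, by simp [hz']; linarith,
        by simp [hz']; linarith⟩, by show z'.re < P.re - ρ'; simp [hz', hxA]; linarith⟩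
      have hseg : segment ℝ z z' ⊆ V \ K := by
        rw [segment_eq_image']
        rintro _ ⟨θ, hθ, rfl⟩
        have hre : (z + θ • (z' - z)).re = z.re + θ * (xA - z.re) := by simp [hz']
        have him : (z + θ • (z' - z)).im = z.im := by simp [hz']
        have hconv : z.re + θ * (xA - z.re) - P.re = (1 - θ) * (z.re - P.re) + θ * (xA - P.re) := by ring
        obtain ⟨ha1, ha2⟩ := abs_lt.1 hzre
        have hb1 : xA - P.re < 0 := by rw [hxA]; linarith
        have hb2 : -W₁ < xA - P.re := by rw [hxA]; linarith
        have h1θ : 0 ≤ 1 - θ := by linarith [hθ.2]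
        have hp1 : (1 - θ) * (z.re - P.re) ≤ 0 := mul_nonpos_iff.2 (Or.inl ⟨h1θ, by linarith⟩)
        have hp2 : θ * (xA - P.re) ≤ 0 := mul_nonpos_iff.2 (Or.inl ⟨hθ.1, hb1.le⟩)
        have hWre : |(z + θ • (z' - z)).re - P.re| < W₁ := by
          rw [hre, abs_lt, hconv]
          set M : ℝ := min (z.re - P.re) (xA - P.re) with hM
          have hMW : -W₁ < M := lt_min ha1 hb2
          have hq1 := mul_le_mul_of_nonneg_left (min_le_left (z.re - P.re) (xA - P.re)) h1θ
          have hq2 := mul_le_mul_of_nonneg_left (min_le_right (z.re - P.re) (xA - P.re)) hθ.1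
          have hid : (1 - θ) * M + θ * M = M := by ring
          constructor
          · linarith
          · linarith
        refine ⟨⟨hWre, by rw [him]; exact hzim1, by rw [him]; exact hzim2⟩, fun hwK => ?_⟩
        rw [mem_closedBall] at hwK
        have h1 := re_le_dist_lowCentre (P := P) (h := h) (z + θ • (z' - z))
        rw [hre] at h1
        by_cases hcase : xA ≤ z.re
        · have hzdist : dist z (P - ↑h * Complex.I) ^ 2 = (z.re - P.re) ^ 2 + (z.im - (P.im - h)) ^ 2 := by
            rw [dist_eq_norm, Complex.sq_norm, Complex.normSq_apply]; simp; ring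
          have hwdist : dist (z + θ • (z' - z)) (P - ↑h * Complex.I) ^ 2 =
              (z.re + θ * (xA - z.re) - P.re) ^ 2 + (z.im - (P.im - h)) ^ 2 := by
            rw [dist_eq_norm, Complex.sq_norm, Complex.normSq_apply]; simp [hz']; ring
          have h0 : 0 ≤ P.re - z.re := by linarith
          have hq : θ * (xA - z.re) ≤ 0 := mul_nonpos_iff.2 (Or.inl ⟨hθ.1, by linarith⟩)
          have h0' : P.re - z.re ≤ P.re - (z.re + θ * (xA - z.re)) := by linarith
          have hmono : (P.re - z.re) ^ 2 ≤ (P.re - (z.re + θ * (xA - z.re))) ^ 2 :=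
            pow_le_pow_left₀ h0 h0' 2
          have hle : dist z (P - ↑h * Complex.I) ^ 2 ≤ dist (z + θ • (z' - z)) (P - ↑h * Complex.I) ^ 2 := by
            rw [hzdist, hwdist]; nlinarith [hmono]
          have hlt : dist (z + θ • (z' - z)) (P - ↑h * Complex.I) ^ 2 < dist z (P - ↑h * Complex.I) ^ 2 :=
            pow_lt_pow_left₀ (hwK.trans_lt hzK') dist_nonneg two_ne_zero
          linarith
        · push Not at hcase
          have hq : (1 - θ) * (z.re - xA) ≤ 0 := mul_nonpos_iff.2 (Or.inl ⟨h1θ, by linarith⟩)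
          have : z.re + θ * (xA - z.re) - P.re < -ρ' := by
            rw [show z.re + θ * (xA - z.re) - P.re = (xA - P.re) + (1 - θ) * (z.re - xA) by ring]
            have : xA - P.re < -ρ' := by rw [hxA]; linarith
            linarith
          rw [abs_of_neg (by linarith)] at h1
          linarith
      exact (JoinedIn.of_segment_subset hseg).trans ((hjoinA hz'A hbAA).trans (hjoinC hbAC hcC))
  have hcVK : c ∈ V \ K := hCsub hcC
  exact (IsPathConnected.isConnected ⟨c, hcVK, fun {z} hz => (hjoin z hz).symm⟩)

/-- **Registered carrier `stub_carvedReduction_lowWindow`** (crux item stmt-CriticalPhenomena-10472,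
stub T-A′ `stub_carvedReduction_squeezeGeometry_domains`, piece THE CORRIDOR BELOW A LOWERED WINDOW):
for `0 < ρ' < W₁`, `0 < h`, `h + ρ' < H₁`, the set
`O = {|re z - re P| < W₁, im P - H₁ < im z < im P - h} ∖ closedBall (P - h i) ρ'` is open and
connected, contains the two docks hanging from `P - h i ∓ ρ'` but their tops, lies strictly below
depth `h` under the gate line, and misses the closed frame rectangle
`[re P ± ρ'] × [im P - h, im P]`, every closed gate ball `closedBall P ρw` with `ρw ≤ h`, and the
closed lowered disc. -/
theorem stub_carvedReduction_lowWindow :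
    ∀ (P : ℂ) (ρ' h W₁ H₁ : ℝ), 0 < ρ' → 0 < h → ρ' < W₁ → h + ρ' < H₁ →
      IsOpen ({z : ℂ | |z.re - P.re| < W₁ ∧ P.im - H₁ < z.im ∧ z.im < P.im - h} \
        closedBall (P - h * Complex.I) ρ') ∧
      IsConnected ({z : ℂ | |z.re - P.re| < W₁ ∧ P.im - H₁ < z.im ∧ z.im < P.im - h} \
        closedBall (P - h * Complex.I) ρ') ∧
      segment ℝ (P - h * Complex.I - ρ') (P - h * Complex.I - ρ' - ((ρ' / 2 : ℝ) : ℂ) * Complex.I) \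
          {P - h * Complex.I - ρ'} ⊆
        {z : ℂ | |z.re - P.re| < W₁ ∧ P.im - H₁ < z.im ∧ z.im < P.im - h} \ closedBall (P - h * Complex.I) ρ' ∧
      segment ℝ (P - h * Complex.I + ρ') (P - h * Complex.I + ρ' - ((ρ' / 2 : ℝ) : ℂ) * Complex.I) \
          {P - h * Complex.I + ρ'} ⊆
        {z : ℂ | |z.re - P.re| < W₁ ∧ P.im - H₁ < z.im ∧ z.im < P.im - h} \ closedBall (P - h * Complex.I) ρ' ∧
      {z : ℂ | |z.re - P.re| < W₁ ∧ P.im - H₁ < z.im ∧ z.im < P.im - h} \ closedBall (P - h * Complex.I) ρ' ⊆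
        {z : ℂ | z.im < P.im - h} ∧
      Disjoint ({z : ℂ | |z.re - P.re| < W₁ ∧ P.im - H₁ < z.im ∧ z.im < P.im - h} \
          closedBall (P - h * Complex.I) ρ')
        {z : ℂ | |z.re - P.re| ≤ ρ' ∧ P.im - h ≤ z.im ∧ z.im ≤ P.im} ∧
      (∀ ρw : ℝ, ρw ≤ h → Disjoint ({z : ℂ | |z.re - P.re| < W₁ ∧ P.im - H₁ < z.im ∧ z.im < P.im - h} \
          closedBall (P - h * Complex.I) ρ') (closedBall P ρw)) ∧
      Disjoint ({z : ℂ | |z.re - P.re| < W₁ ∧ P.im - H₁ < z.im ∧ z.im < P.im - h} \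
          closedBall (P - h * Complex.I) ρ') (closedBall (P - h * Complex.I) ρ') := by
  intro P ρ' h W₁ H₁ hρ' hh hW hH
  set V : Set ℂ := {z : ℂ | |z.re - P.re| < W₁ ∧ P.im - H₁ < z.im ∧ z.im < P.im - h} with hV
  set K : Set ℂ := closedBall (P - h * Complex.I) ρ' with hK
  have hVo : IsOpen V := by
    have : V = ((fun z : ℂ => |z.re - P.re|) ⁻¹' Iio W₁) ∩ (Complex.im ⁻¹' Ioo (P.im - H₁) (P.im - h)) := by
      ext z; simp [hV]
    rw [this]
    exact ((continuous_abs.comp (Complex.continuous_re.sub continuous_const)).isOpen_preimage _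
      isOpen_Iio).inter (Complex.continuous_im.isOpen_preimage _ isOpen_Ioo)
  -- docks
  have hdock : ∀ (σ : ℝ), |σ| = ρ' →
      segment ℝ (P - h * Complex.I + σ) (P - h * Complex.I + σ - ((ρ' / 2 : ℝ) : ℂ) * Complex.I) \
        {P - h * Complex.I + σ} ⊆ V \ K := by
    intro σ hσ
    rintro z ⟨hz, hztop⟩
    obtain ⟨hre, him, htop⟩ := mem_dock hρ' hz
    have hre' : z.re = P.re + σ := by rw [hre]; simp
    have him' : z.im < P.im - h := by
      have h1 : (P - ↑h * Complex.I + ↑σ).im = P.im - h := by simp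
      rcases (h1 ▸ him).lt_or_eq with hlt | heq
      · exact hlt
      · exact absurd (htop (by rw [heq, h1])) hztop
    -- height range on the dock
    have hlow : P.im - h - ρ' / 2 ≤ z.im := by
      rw [segment_eq_image'] at hz
      obtain ⟨θ, hθ, rfl⟩ := hz
      simp; nlinarith [hθ.2]
    refine ⟨⟨by rw [hre', add_sub_cancel_left, hσ]; exact hW, by linarith, him'⟩, fun hzK => ?_⟩
    rw [hK, mem_closedBall] at hzK
    have hsq : dist z (P - ↑h * Complex.I) ^ 2 = (z.re - P.re) ^ 2 + (z.im - (P.im - h)) ^ 2 := by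
      rw [dist_eq_norm, Complex.sq_norm, Complex.normSq_apply]; simp; ring
    have hσ2 : (z.re - P.re) ^ 2 = ρ' ^ 2 := by rw [hre', add_sub_cancel_left, ← hσ, sq_abs]
    have hpos : 0 < (z.im - (P.im - h)) ^ 2 := by
      have : z.im - (P.im - h) ≠ 0 := by intro h0; linarith
      positivity
    nlinarith [dist_nonneg (x := z) (y := P - ↑h * Complex.I)]
  have hdL := hdock (-ρ') (by rw [abs_neg, abs_of_pos hρ'])
  have hdR := hdock ρ' (abs_of_pos hρ')
  simp only [Complex.ofReal_neg, ← sub_eq_add_neg] at hdL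
  refine ⟨hVo.sdiff isClosed_closedBall, isConnected_lowWindow hρ' hW hH, hdL, hdR,
    fun z hz => hz.1.2.2, ?_, fun ρw hρw => ?_, disjoint_sdiff_left⟩
  · exact Set.disjoint_left.2 fun z hz hzR => by
      have h1 : z.im < P.im - h := hz.1.2.2
      linarith [hzR.2.1]
  · refine Set.disjoint_left.2 fun z hz hzB => ?_
    have h1 : z.im < P.im - h := hz.1.2.2
    rw [mem_closedBall, dist_eq_norm] at hzB
    have h2 : |(z - P).im| ≤ ‖z - P‖ := Complex.abs_im_le_norm _
    rw [Complex.sub_im] at h2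
    have h3 : P.im - z.im ≤ ρw := by
      have := neg_abs_le (z.im - P.im); linarith
    linarith

end LowWindow

end Summit.CriticalPhenomena.SAWScalingLimit.Theorems.ObservableToSLE.TypeLadder

end
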